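import Summits.QuantumFields.BalabanUV.Beta.GAN24.T2SlotUnits
import Summits.QuantumFields.BalabanUV.Beta.GAN24.BiStencilZeroMode
import Summits.QuantumFields.BalabanUV.Beta.GAN24.TransversalZeroMode

/-!
# `BalabanUV.Beta.GAN24.WSlotFirstDiff` — binder row G-an2-4 / (CONV-C), W-slot road «W3», ROW W3-F4d of the row owner's
# SKELETON-W3 v1.0 §8.3 («the first difference: shape + zero mode») — PART 1: the SHAPE `hD0` of the first difference
# `T♮₁ − T♮₀` of an2's normalised Stage-B bi-stencil family, and the PIN SIDE `hZ0` in kernel form: on `LocStencil₂` tables the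
# zero-mode charge `zmode` is additive, so `hZ0` ⟺ «the field–field charge is CONSERVED at the first step» (RULINGS-14d)

NOT IN PRINT; OUR PROOF ATTEMPT (G-an2-4 formalisation swarm, leaf prover `b2b-balaban-gan24-formalise-leaf-07`, gen 12; journal INTENT
«W3-F4D*»; module name PROVISIONAL — the row owner gan24-p1 may rename / re-cut).  HONEST FRAMING (cell contract, verbatim): «discharging
`BetaPertH` makes Bałaban's UV stability UNCONDITIONAL — a real constructive-QFT result; it is NOT the continuum limit and NOT the Clay
problem.»  HONEST DEPENDENCY (verbatim): «continuum YM on T⁴ ⇐ BetaPertH ∧ nine spine estimates (0/9 proved); BetaPertH ⇐ (D1) ∧ (D4) ∧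
CAP+tail; G-an2-4 gates asym, D1 and NE2/3/4.»
v1.2 DOCFIX (leaf prover `b2b-balaban-gan24-formalise-leaf-01`, gen 34, orphan adoption; ref1's notice REFEREE-GAN24.md l.1192 (iii)): §3's bullet
below printed the pin with a MINUS sign; the sign of record is `+` — the multiplier is `λ = cE₂·Lc^{−(d+5)}` (kernel: the factor
`(cE₂ * ((Lc:ℝ)^(d+5))⁻¹ − 1)` of `GAN24/FirstDiffSymCharge.symZ_firstDiff_eq`) and the exact pin is `hpinEq : cE₂ = (Lc:ℝ)^(2*(3+1))`
(`GAN24/W3PinCountdown`'s binder; `GAN24/W3PinLock.lock2_pos`).  Docstring only; every v1.1 declaration byte-identical.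

CONTEXT.  The owner's END #2 `GAN24/WSlotT2OfPieces.rate_of_rows` ∕ `t2Drift_of_rows` (p211117) turns the DIFFERENCE tower
`D n := T♮_{n+1} − T♮_n` of the normalised family `T♮_j := unitS₂ (sfStep Lc j) (smStep d Lc j) (T2Of d Lc cE cVH cΛ cE₂ cB Tc (vh₂S d Lc) mixFF j)`
(leaf-19's `T2SlotUnits` currency) into «T2Drift» ∕ «T2SupRate», given — among the five row families — the member-`0` data
`h0 : LocStencil₂ (D 0) C₀ δin ∧ mom (D 0) ≤ C₀` and `hZ0 : Zfree (D 0)`, with `Zfree X := ∀ κ κ′ α β, zmode Lc X κ κ′ (inl α) (inl β) = 0`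
(RULINGS-14b (R14-6): the field–field zero mode of leaf-02's `BiStencilZeroMode.zmode`) and `mom := fun _ ↦ 0` (the F3b holder's choice, R14-3).
THIS FILE ([folklore] bookkeeping over tree theorems, generic `d`, `1 ≤ Lc`):
* §1 `locStencil₂_unitS₂` — the change of units `unitS₂` preserves the `LocStencil₂` shape (constant `|(s_f s_m)⁻¹|²·U′·C·U′`,
  `U′ = max |s_f⁻¹| |s_m⁻¹|`; an2∕an4's `biLoc_counitK` twice removed).
* §2 **`shape_pair`**, **`hD0_shape`** — members `0` and `1` of the normalised family, HENCE THEIR DIFFERENCE `D 0`, are `LocStencil₂` families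
  at one common positive rate and at every smaller rate `δ ≥ 0` (an2's member-wise `BalabanStepW2.T2Of_loc` at `j = 0, 1` — ONE step needs no
  uniformity — under the mixed-table shape binder `hmix` in ∃-form, ref2 r49 (v)); with `mom := fun _ ↦ 0` the END's conjunct `mom (D 0) ≤ C₀`
  is `0 ≤ C₀`, supplied (`hD0_pair`).  This is the `h0` text of `t2Drift_of_rows` up to the choice `δin ≤ δ₀` (RULINGS-14 (R14-2)).
* §3 THE PIN SIDE IN KERNEL FORM — `summable_*`∕`abs_tsum*_le` (the three inner series of `zmode` converge absolutely on a `LocStencil₂` table at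
  rate `δ > 0`), **`zmode_sub`**, `zmode_add`, `zmode_smul`, whence **`zff_sub_iff`** and its instance **`hZ0_iff_chargeConserved`**:
  `(∀ κ κ′ α β, zmode Lc (T♮₁ − T♮₀) κ κ′ (inl α) (inl β) = 0) ↔ (∀ κ κ′ α β, zmode Lc T♮₁ κ κ′ (inl α) (inl β) = zmode Lc T♮₀ κ κ′ (inl α) (inl β))`
  — RULINGS-14d ∕ SKELETON-W3 §8.5 (N-F4d) («at the exact pin the ff-charge is CONSERVED along the tower») as the row's literal reformulation.
  By the owner's count (leaf-20-g17 l.8095, leaf-18-g16 l.8126: `Z_ff(T♮₁ − T♮₀) = (λ − 1)·Z_ff(T♮₀)`, `Z(wilsonW₂) ≠ 0`) the right-hand side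
  holds iff `λ = cE₂·Lc^{−(d+5)} = 1`, i.e. under the EXACT pin `hpinEq : cE₂ = (Lc:ℝ)^(2*(3+1))` at `d = 3` — PART 2 of this row
  (`hZ0_of_pinEq` ⇐ leaf-04's affine split `T2RecursionAffine` ⨾ leaf-02's (Z0) `LinT2ZeroMode` ⨾ ROW W3-F2a at `m = 0` ⨾ §3 ⨾ `hpinEq`) is filed
  when those inputs are tree declarations, and asserts nothing before.
* §3″ (v1.1, APPEND-ONLY; every v1 declaration byte-identical) THE SAME IN THE POINTWISE TRANSVERSAL CURRENCY of leaf-16-g12's NOTE «ZFREE-POINTWISE»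
  (journal l.8198; bridge `GAN24/TransversalZeroMode` p211950): with `Zfree X := ∀ κ u κ′ α β, Σ'_{u′} Σ'_x Σ'_z X κ u κ′ u′ x z (inl α) (inl β) = 0` (EVERY first
  bond, not the origin cell — the instantiation under which the ∀-X row `hTirr` is true), `inner_sub_of_locStencil₂` (leaf-16's `inner_sub_eq` with its six
  summabilities DISCHARGED from `LocStencil₂` by §3), `innerff_sub_iff`, and the row's twins **`hZ0pt_iff_chargeConservedPt`** ∕ `hZ0pt_of_chargeConservedPt` —
  so ROW W3-F4d PART 1 serves EITHER ruling on `Zfree` (cell form §3′, pointwise form §3″).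
Asserts NO shape of Bałaban's tables beyond an2's own `T2Of_loc`; the pin is an2's (P6) to discharge; discharges NOTHING of «T2Shape» ∕
«T2SupRate» ∕ (hW, hWall) by itself (one S–M row of ten); D1-wall binder families of record K 2∕2, S 2∕2 tree theorems at d = 3, Lc ≥ 2; W 0∕2;
NOT «W-slot closed», NEVER «G-an2-4 closed»; NOT BetaPertH, NOT continuum, NOT Clay.  0 cited facts, 0 `Prop` mirrors, 0 sorry.
-/

noncomputable section

open Finset
open scoped BigOperators
open Literature.MathematicalPhysics.QuantumFieldTheory
open Literature.MathematicalPhysics.QuantumFieldTheory.Balaban1983to89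
open Literature.MathematicalPhysics.QuantumFieldTheory.Balaban1983to89.Beta
open B12Sec2to5 (l1 l1_nonneg)
open ExpKernelCalculus (MKer BiLoc Zl Zl_nonneg summable_exp_shift' tsum_exp_shift')
open OneStepResolventKernel (Fib)
open AffineAveraging (box toSite)
open BalabanCompositeJets (LocStencil₂)
open SecondOrderResponse (LocStencilFM)
open BalabanStepW2 (T2Of T2Of_loc locStencil₂_smul' locStencil₂_add')
open AveragingMixedJetTables (vh₂S)
open Summit.QuantumFields.BalabanUV.Beta.HessKerDressedUnits (counitK counitK_apply biLoc_counitK)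
open Summit.QuantumFields.BalabanUV.Beta.SecondOrderUnits (unitS₂)
open Summit.QuantumFields.BalabanUV.Beta.GAN24.CombesThomas (sfStep smStep)
open Summit.QuantumFields.BalabanUV.Beta.GAN24.T2SlotUnits (unitS₂_apply locStencil₂_vh₂S)
open Summit.QuantumFields.BalabanUV.Beta.GAN24.BiStencilZeroMode (zmode)

namespace Summit.QuantumFields.BalabanUV.Beta.GAN24.WSlotFirstDiff

variable {d : ℕ}

/-! ## §1 The change of units `unitS₂` preserves the `LocStencil₂` shape -/

/-- [folklore] **`unitS₂` PRESERVES `LocStencil₂`** (crude class transport, any real units `s_f, s_m`): constant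
`|(s_f s_m)⁻¹|·|(s_f s_m)⁻¹|·(U′·C·U′)`, `U′ = max |s_f⁻¹| |s_m⁻¹|`, same rate (`unitS₂ = (s_f s_m)⁻²·D⁻¹(·)D⁻¹` entrywise). -/
theorem locStencil₂_unitS₂ (sf sm : ℝ)
    {S₂ : Fin (d + 1) → (Fin (d + 1) → ℤ) → Fin (d + 1) → (Fin (d + 1) → ℤ) → MKer (d + 1) (Fib d)} {C δ : ℝ}
    (h : LocStencil₂ S₂ C δ) :
    LocStencil₂ (unitS₂ sf sm S₂)
      (|(sf * sm)⁻¹| * (|(sf * sm)⁻¹| * (max |sf⁻¹| |sm⁻¹| * C * max |sf⁻¹| |sm⁻¹|))) δ := by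
  intro κ u κ' u' x z a b
  have h1 := biLoc_counitK (sf := sf) (sm := sm) (h κ u κ' u') x z a b
  have e : unitS₂ sf sm S₂ κ u κ' u' x z a b = (sf * sm)⁻¹ * ((sf * sm)⁻¹ * counitK sf sm (S₂ κ u κ' u') x z a b) := by
    rw [unitS₂_apply, counitK_apply]
  rw [e, abs_mul, abs_mul]
  calc |(sf * sm)⁻¹| * (|(sf * sm)⁻¹| * |counitK sf sm (S₂ κ u κ' u') x z a b|)
      ≤ |(sf * sm)⁻¹| * (|(sf * sm)⁻¹| * (max |sf⁻¹| |sm⁻¹| * (C * Real.exp (-δ * l1 (u' - u))) * max |sf⁻¹| |sm⁻¹|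
          * Real.exp (-δ * (l1 (x - u) + l1 (z - u))))) := by gcongr
    _ = _ := by ring

/-! ## §2 ROW W3-F4d, shape half: members `0`, `1` and their difference at one common rate -/

section Shape

variable {Lc : ℕ} [NeZero Lc]

/-- [folklore] **MEMBERS `0` AND `1` OF THE NORMALISED FAMILY AT ONE COMMON POSITIVE RATE** (an2's member-wise `T2Of_loc` at `j = 0, 1`
— a single step needs no `j`-uniformity — transported through `unitS₂` by §1), under the mixed-table shape binder `hmix` (∃-form). -/
theorem shape_pair (hLc : 1 ≤ Lc) (cE cVH cΛ cE₂ cB : ℝ) (Tc : Fin 4 → Fin 4 → Fin 4 → Fin 4 → ℝ)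
    {mixFF : Fin (d + 1) → (Fin (d + 1) → ℤ) → Fin (d + 1) → (Fin (d + 1) → ℤ) → MKer (d + 1) (Fib d)}
    (hmix : ∃ C δ : ℝ, 0 < δ ∧ LocStencilFM Lc mixFF C δ) :
    ∃ C₀ C₁ δ₀ : ℝ, 0 < δ₀ ∧ 0 ≤ C₀ ∧ 0 ≤ C₁ ∧
      LocStencil₂ (unitS₂ (sfStep Lc 0) (smStep d Lc 0) (T2Of d Lc cE cVH cΛ cE₂ cB Tc (vh₂S d Lc) mixFF 0)) C₀ δ₀ ∧
      LocStencil₂ (unitS₂ (sfStep Lc 1) (smStep d Lc 1) (T2Of d Lc cE cVH cΛ cE₂ cB Tc (vh₂S d Lc) mixFF 1)) C₁ δ₀ := by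
  have hB : ∃ C δ : ℝ, 0 < δ ∧ LocStencil₂ (vh₂S d Lc) C δ := ⟨_, 1, one_pos, locStencil₂_vh₂S hLc zero_le_one⟩
  obtain ⟨A₀, δa, hδa, h₀⟩ := T2Of_loc hLc cE cVH cΛ cE₂ cB Tc hB hmix 0
  obtain ⟨A₁, δb, hδb, h₁⟩ := T2Of_loc hLc cE cVH cΛ cE₂ cB Tc hB hmix 1
  have u0 := locStencil₂_unitS₂ (sfStep Lc 0) (smStep d Lc 0) h₀
  have u1 := locStencil₂_unitS₂ (sfStep Lc 1) (smStep d Lc 1) h₁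
  exact ⟨_, _, min δa δb, lt_min hδa hδb, u0.nonneg, u1.nonneg, u0.mono (min_le_left _ _), u1.mono (min_le_right _ _)⟩

/-- **ROW W3-F4d, SHAPE HALF `hD0`** [folklore]: the first difference `D 0 = T♮₁ − T♮₀` of an2's normalised Stage-B family is a `LocStencil₂`
family — SOME constant `C₀ ≥ 0` and SOME rate `δ₀ > 0` work, and then every rate `δ ≤ δ₀` (take the END's `δin ≤ δ₀`, RULINGS-14 (R14-2)).
The table is LITERALLY the `D 0` of `WSlotT2OfPieces.t2Drift_of_rows`. -/
theorem hD0_shape (hLc : 1 ≤ Lc) (cE cVH cΛ cE₂ cB : ℝ) (Tc : Fin 4 → Fin 4 → Fin 4 → Fin 4 → ℝ)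
    {mixFF : Fin (d + 1) → (Fin (d + 1) → ℤ) → Fin (d + 1) → (Fin (d + 1) → ℤ) → MKer (d + 1) (Fib d)}
    (hmix : ∃ C δ : ℝ, 0 < δ ∧ LocStencilFM Lc mixFF C δ) :
    ∃ C₀ δ₀ : ℝ, 0 < δ₀ ∧ 0 ≤ C₀ ∧ ∀ δ : ℝ, δ ≤ δ₀ →
      LocStencil₂ (fun κ u κ' u' =>
        unitS₂ (sfStep Lc 1) (smStep d Lc 1) (T2Of d Lc cE cVH cΛ cE₂ cB Tc (vh₂S d Lc) mixFF 1) κ u κ' u'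
          - unitS₂ (sfStep Lc 0) (smStep d Lc 0) (T2Of d Lc cE cVH cΛ cE₂ cB Tc (vh₂S d Lc) mixFF 0) κ u κ' u') C₀ δ := by
  obtain ⟨C₀, C₁, δ₀, hδ₀, hC₀, hC₁, h₀, h₁⟩ := shape_pair hLc cE cVH cΛ cE₂ cB Tc hmix
  refine ⟨C₁ + |(-1 : ℝ)| * C₀, δ₀, hδ₀, by positivity, fun δ hδ => ?_⟩
  have e : (fun κ u κ' u' =>
        unitS₂ (sfStep Lc 1) (smStep d Lc 1) (T2Of d Lc cE cVH cΛ cE₂ cB Tc (vh₂S d Lc) mixFF 1) κ u κ' u'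
          - unitS₂ (sfStep Lc 0) (smStep d Lc 0) (T2Of d Lc cE cVH cΛ cE₂ cB Tc (vh₂S d Lc) mixFF 0) κ u κ' u')
      = fun κ u κ' u' =>
        unitS₂ (sfStep Lc 1) (smStep d Lc 1) (T2Of d Lc cE cVH cΛ cE₂ cB Tc (vh₂S d Lc) mixFF 1) κ u κ' u'
          + (-1 : ℝ) • unitS₂ (sfStep Lc 0) (smStep d Lc 0) (T2Of d Lc cE cVH cΛ cE₂ cB Tc (vh₂S d Lc) mixFF 0) κ u κ' u' := by
    funext κ u κ' u'
    rw [neg_one_smul, sub_eq_add_neg]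
  rw [e]
  exact locStencil₂_add' (h₁.mono hδ) (locStencil₂_smul' (-1) (h₀.mono hδ))

/-- **ROW W3-F4d, the END's `h0` PAIR at `mom := fun _ ↦ 0`** [folklore]: `LocStencil₂ (D 0) C₀ δ ∧ (fun _ ↦ (0:ℝ)) (D 0) ≤ C₀`. -/
theorem hD0_pair (hLc : 1 ≤ Lc) (cE cVH cΛ cE₂ cB : ℝ) (Tc : Fin 4 → Fin 4 → Fin 4 → Fin 4 → ℝ)
    {mixFF : Fin (d + 1) → (Fin (d + 1) → ℤ) → Fin (d + 1) → (Fin (d + 1) → ℤ) → MKer (d + 1) (Fib d)}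
    (hmix : ∃ C δ : ℝ, 0 < δ ∧ LocStencilFM Lc mixFF C δ) :
    ∃ C₀ δ₀ : ℝ, 0 < δ₀ ∧ ∀ δ : ℝ, δ ≤ δ₀ →
      LocStencil₂ (fun κ u κ' u' =>
        unitS₂ (sfStep Lc 1) (smStep d Lc 1) (T2Of d Lc cE cVH cΛ cE₂ cB Tc (vh₂S d Lc) mixFF 1) κ u κ' u'
          - unitS₂ (sfStep Lc 0) (smStep d Lc 0) (T2Of d Lc cE cVH cΛ cE₂ cB Tc (vh₂S d Lc) mixFF 0) κ u κ' u') C₀ δ ∧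
      (fun _ : Fin (d + 1) → (Fin (d + 1) → ℤ) → Fin (d + 1) → (Fin (d + 1) → ℤ) → MKer (d + 1) (Fib d) => (0 : ℝ))
        (fun κ u κ' u' =>
          unitS₂ (sfStep Lc 1) (smStep d Lc 1) (T2Of d Lc cE cVH cΛ cE₂ cB Tc (vh₂S d Lc) mixFF 1) κ u κ' u'
            - unitS₂ (sfStep Lc 0) (smStep d Lc 0) (T2Of d Lc cE cVH cΛ cE₂ cB Tc (vh₂S d Lc) mixFF 0) κ u κ' u') ≤ C₀ := by
  obtain ⟨C₀, δ₀, hδ₀, hC₀, h⟩ := hD0_shape hLc cE cVH cΛ cE₂ cB Tc hmix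
  exact ⟨C₀, δ₀, hδ₀, fun δ hδ => ⟨h δ hδ, hC₀⟩⟩

end Shape

/-! ## §3 The pin side in kernel form: `zmode` is additive on `LocStencil₂` tables -/

section Charge

/-- [folklore] Innermost series of a bi-localised kernel: `z ↦ V x z a b` is summable and `|Σ'_z V x z a b| ≤ A·Zl(δ)·e^{−δ|x−p|₁}`. -/
theorem summable_z {V : MKer (d + 1) (Fib d)} {p : Fin (d + 1) → ℤ} {A δ : ℝ} (hV : BiLoc V p p A δ) (hδ : 0 < δ)
    (x : Fin (d + 1) → ℤ) (a b : Fib d) : Summable fun z => V x z a b :=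
  Summable.of_norm_bounded ((summable_exp_shift' hδ p).mul_left (A * Real.exp (-δ * l1 (x - p)))) (fun z => by
    rw [Real.norm_eq_abs]
    refine (hV x z a b).trans_eq ?_
    rw [mul_add, Real.exp_add, mul_assoc])

/-- [folklore] … with the bound `|Σ'_z V x z a b| ≤ A·Zl(δ)·e^{−δ|x−p|₁}`. -/
theorem abs_tsum_z_le {V : MKer (d + 1) (Fib d)} {p : Fin (d + 1) → ℤ} {A δ : ℝ} (hV : BiLoc V p p A δ) (hδ : 0 < δ)
    (x : Fin (d + 1) → ℤ) (a b : Fib d) : |∑' z, V x z a b| ≤ A * Zl (d + 1) δ * Real.exp (-δ * l1 (x - p)) := by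
  have hs : HasSum (fun z : Fin (d + 1) → ℤ => A * Real.exp (-δ * l1 (x - p)) * Real.exp (-δ * l1 (z - p)))
      (A * Real.exp (-δ * l1 (x - p)) * Zl (d + 1) δ) := by
    rw [← tsum_exp_shift' (c := δ) p]
    exact ((summable_exp_shift' hδ p).hasSum).mul_left _
  have h := tsum_of_norm_bounded hs (fun z => by
    rw [Real.norm_eq_abs]
    refine (hV x z a b).trans_eq ?_
    rw [mul_add, Real.exp_add, mul_assoc])
  rw [Real.norm_eq_abs] at h
  refine h.trans_eq ?_
  ring

/-- [folklore] Middle series: `x ↦ Σ'_z V x z a b` is summable. -/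
theorem summable_xz {V : MKer (d + 1) (Fib d)} {p : Fin (d + 1) → ℤ} {A δ : ℝ} (hV : BiLoc V p p A δ) (hδ : 0 < δ)
    (a b : Fib d) : Summable fun x => ∑' z, V x z a b :=
  Summable.of_norm_bounded ((summable_exp_shift' hδ p).mul_left (A * Zl (d + 1) δ)) (fun x => by
    rw [Real.norm_eq_abs]
    exact abs_tsum_z_le hV hδ x a b)

/-- [folklore] … with the bound `|Σ'_x Σ'_z V x z a b| ≤ A·Zl(δ)²`. -/
theorem abs_tsum_xz_le {V : MKer (d + 1) (Fib d)} {p : Fin (d + 1) → ℤ} {A δ : ℝ} (hV : BiLoc V p p A δ) (hδ : 0 < δ)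
    (a b : Fib d) : |∑' x, ∑' z, V x z a b| ≤ A * Zl (d + 1) δ * Zl (d + 1) δ := by
  have hs : HasSum (fun x : Fin (d + 1) → ℤ => A * Zl (d + 1) δ * Real.exp (-δ * l1 (x - p)))
      (A * Zl (d + 1) δ * Zl (d + 1) δ) := by
    rw [← tsum_exp_shift' (c := δ) p]
    exact ((summable_exp_shift' hδ p).hasSum).mul_left _
  have h := tsum_of_norm_bounded hs (fun x => by
    rw [Real.norm_eq_abs]
    exact abs_tsum_z_le hV hδ x a b)
  rw [Real.norm_eq_abs] at h
  exact h

variable {S₂ : Fin (d + 1) → (Fin (d + 1) → ℤ) → Fin (d + 1) → (Fin (d + 1) → ℤ) → MKer (d + 1) (Fib d)} {C δ : ℝ}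

/-- [folklore] Outer series of a `LocStencil₂` table: `u′ ↦ Σ'_x Σ'_z S₂ κ u κ′ u′ x z a b` is summable (bound `C·Zl(δ)²·e^{−δ|u′−u|₁}`). -/
theorem summable_u'xz (h : LocStencil₂ S₂ C δ) (hδ : 0 < δ) (κ : Fin (d + 1)) (u : Fin (d + 1) → ℤ) (κ' : Fin (d + 1))
    (a b : Fib d) : Summable fun u' => ∑' x, ∑' z, S₂ κ u κ' u' x z a b :=
  Summable.of_norm_bounded ((summable_exp_shift' hδ u).mul_left (C * Zl (d + 1) δ * Zl (d + 1) δ)) (fun u' => by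
    rw [Real.norm_eq_abs]
    refine (abs_tsum_xz_le (h κ u κ' u') hδ a b).trans_eq ?_
    ring)

/-- [folklore] … with the bound `|Σ'_{u′} Σ'_x Σ'_z S₂ κ u κ′ u′ x z a b| ≤ C·Zl(δ)³` (the zero-mode charge of one first-bond position is finite). -/
theorem abs_tsum_u'xz_le (h : LocStencil₂ S₂ C δ) (hδ : 0 < δ) (κ : Fin (d + 1)) (u : Fin (d + 1) → ℤ) (κ' : Fin (d + 1))
    (a b : Fib d) : |∑' u', ∑' x, ∑' z, S₂ κ u κ' u' x z a b| ≤ C * Zl (d + 1) δ * Zl (d + 1) δ * Zl (d + 1) δ := by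
  have hs : HasSum (fun u' : Fin (d + 1) → ℤ => C * Zl (d + 1) δ * Zl (d + 1) δ * Real.exp (-δ * l1 (u' - u)))
      (C * Zl (d + 1) δ * Zl (d + 1) δ * Zl (d + 1) δ) := by
    rw [← tsum_exp_shift' (c := δ) u]
    exact ((summable_exp_shift' hδ u).hasSum).mul_left _
  have hb := tsum_of_norm_bounded hs (fun u' => by
    rw [Real.norm_eq_abs]
    refine (abs_tsum_xz_le (h κ u κ' u') hδ a b).trans_eq ?_
    ring)
  rw [Real.norm_eq_abs] at hb
  exact hb

variable {N : ℕ}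

/-- [folklore] **`zmode` OF A SCALAR MULTIPLE** (no summability needed): `zmode N (c • S₂) = c · zmode N S₂`. -/
theorem zmode_smul (c : ℝ) (S₂ : Fin (d + 1) → (Fin (d + 1) → ℤ) → Fin (d + 1) → (Fin (d + 1) → ℤ) → MKer (d + 1) (Fib d))
    (κ κ' : Fin (d + 1)) (a b : Fib d) :
    zmode N (fun κ u κ' u' => c • S₂ κ u κ' u') κ κ' a b = c * zmode N S₂ κ κ' a b := by
  simp only [zmode, Pi.smul_apply, smul_eq_mul, tsum_mul_left, Finset.mul_sum]

variable {A B : Fin (d + 1) → (Fin (d + 1) → ℤ) → Fin (d + 1) → (Fin (d + 1) → ℤ) → MKer (d + 1) (Fib d)} {CA CB : ℝ}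

/-- [folklore] **`zmode` IS ADDITIVE ON `LocStencil₂` TABLES** (rate `δ > 0`; the three inner series converge absolutely, `tsum_add` thrice). -/
theorem zmode_add (hA : LocStencil₂ A CA δ) (hB : LocStencil₂ B CB δ) (hδ : 0 < δ) (κ κ' : Fin (d + 1)) (a b : Fib d) :
    zmode N (fun κ u κ' u' => A κ u κ' u' + B κ u κ' u') κ κ' a b = zmode N A κ κ' a b + zmode N B κ κ' a b := by
  simp only [zmode]
  rw [← Finset.sum_add_distrib]
  refine Finset.sum_congr rfl fun r _ => ?_
  have hz : ∀ u' x : Fin (d + 1) → ℤ, (∑' z, (A κ (toSite r) κ' u' + B κ (toSite r) κ' u') x z a b)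
      = (∑' z, A κ (toSite r) κ' u' x z a b) + ∑' z, B κ (toSite r) κ' u' x z a b := fun u' x => by
    simp only [Pi.add_apply]
    exact (summable_z (hA κ (toSite r) κ' u') hδ x a b).tsum_add (summable_z (hB κ (toSite r) κ' u') hδ x a b)
  have hx : ∀ u' : Fin (d + 1) → ℤ, (∑' x, ∑' z, (A κ (toSite r) κ' u' + B κ (toSite r) κ' u') x z a b)
      = (∑' x, ∑' z, A κ (toSite r) κ' u' x z a b) + ∑' x, ∑' z, B κ (toSite r) κ' u' x z a b := fun u' => by
    rw [tsum_congr (hz u')]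
    exact (summable_xz (hA κ (toSite r) κ' u') hδ a b).tsum_add (summable_xz (hB κ (toSite r) κ' u') hδ a b)
  rw [tsum_congr hx]
  exact (summable_u'xz hA hδ κ (toSite r) κ' a b).tsum_add (summable_u'xz hB hδ κ (toSite r) κ' a b)

/-- [folklore] **`zmode` IS SUBTRACTIVE ON `LocStencil₂` TABLES**: `zmode N (A − B) = zmode N A − zmode N B`. -/
theorem zmode_sub (hA : LocStencil₂ A CA δ) (hB : LocStencil₂ B CB δ) (hδ : 0 < δ) (κ κ' : Fin (d + 1)) (a b : Fib d) :
    zmode N (fun κ u κ' u' => A κ u κ' u' - B κ u κ' u') κ κ' a b = zmode N A κ κ' a b - zmode N B κ κ' a b := by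
  have e : (fun κ u κ' u' => A κ u κ' u' - B κ u κ' u') = fun κ u κ' u' => A κ u κ' u' + (-1 : ℝ) • B κ u κ' u' := by
    funext κ u κ' u'
    rw [neg_one_smul, sub_eq_add_neg]
  rw [e, zmode_add hA (locStencil₂_smul' (-1) hB) hδ, zmode_smul, neg_one_mul, sub_eq_add_neg]

/-- [folklore] **ZERO FIELD–FIELD CHARGE OF A DIFFERENCE ⟺ EQUAL FIELD–FIELD CHARGES** (RULINGS-14b (R14-6) slots): for `LocStencil₂` tables
`A`, `B` at a common rate `δ > 0`,
`(∀ κ κ′ α β, zmode N (A − B) κ κ′ (inl α) (inl β) = 0) ↔ (∀ κ κ′ α β, zmode N A κ κ′ (inl α) (inl β) = zmode N B κ κ′ (inl α) (inl β))`. -/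
theorem zff_sub_iff (hA : LocStencil₂ A CA δ) (hB : LocStencil₂ B CB δ) (hδ : 0 < δ) :
    (∀ (κ κ' α β : Fin (d + 1)), zmode N (fun κ u κ' u' => A κ u κ' u' - B κ u κ' u') κ κ' (Sum.inl α) (Sum.inl β) = 0) ↔
      ∀ (κ κ' α β : Fin (d + 1)), zmode N A κ κ' (Sum.inl α) (Sum.inl β) = zmode N B κ κ' (Sum.inl α) (Sum.inl β) := by
  simp only [zmode_sub hA hB hδ, sub_eq_zero]

end Charge

/-! ## §3′ ROW W3-F4d, pin half in kernel form: `hZ0` ⟺ the field–field charge is conserved at the first step -/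

section Pin

variable {Lc : ℕ} [NeZero Lc]

/-- **ROW W3-F4d, `hZ0` ⟺ FIELD–FIELD CHARGE CONSERVATION AT THE FIRST STEP** [folklore reformulation; RULINGS-14d ∕ SKELETON-W3 §8.5 (N-F4d)]:
for an2's normalised Stage-B family, the END's hypothesis `hZ0 : Zfree (T♮₁ − T♮₀)` (ff slots, R14-6) holds IFF
`zmode Lc T♮₁ κ κ′ (inl α) (inl β) = zmode Lc T♮₀ κ κ′ (inl α) (inl β)` for all direction labels — the ff-charge of member `1` equals that of
member `0`.  By the owner's count (leaf-02's (Z0): `Z_ff(lin4₀ X) = λ·Z_ff X`, ROW W3-F2a at `m = 0`: `Z_ff(b₀) = 0`) the right-hand side reads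
`(λ − 1)·Z_ff(T♮₀) = 0` with `Z_ff(T♮₀) ≠ 0` (leaf-18-g16 l.8126), i.e. `λ = 1`: the EXACT pin — PART 2 (`hZ0_of_pinEq`), not asserted here. -/
theorem hZ0_iff_chargeConserved (hLc : 1 ≤ Lc) (cE cVH cΛ cE₂ cB : ℝ) (Tc : Fin 4 → Fin 4 → Fin 4 → Fin 4 → ℝ)
    {mixFF : Fin (d + 1) → (Fin (d + 1) → ℤ) → Fin (d + 1) → (Fin (d + 1) → ℤ) → MKer (d + 1) (Fib d)}
    (hmix : ∃ C δ : ℝ, 0 < δ ∧ LocStencilFM Lc mixFF C δ) :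
    (∀ (κ κ' α β : Fin (d + 1)), zmode Lc (fun κ u κ' u' =>
        unitS₂ (sfStep Lc 1) (smStep d Lc 1) (T2Of d Lc cE cVH cΛ cE₂ cB Tc (vh₂S d Lc) mixFF 1) κ u κ' u'
          - unitS₂ (sfStep Lc 0) (smStep d Lc 0) (T2Of d Lc cE cVH cΛ cE₂ cB Tc (vh₂S d Lc) mixFF 0) κ u κ' u')
        κ κ' (Sum.inl α) (Sum.inl β) = 0) ↔
      ∀ (κ κ' α β : Fin (d + 1)),
        zmode Lc (unitS₂ (sfStep Lc 1) (smStep d Lc 1) (T2Of d Lc cE cVH cΛ cE₂ cB Tc (vh₂S d Lc) mixFF 1)) κ κ' (Sum.inl α) (Sum.inl β)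
          = zmode Lc (unitS₂ (sfStep Lc 0) (smStep d Lc 0) (T2Of d Lc cE cVH cΛ cE₂ cB Tc (vh₂S d Lc) mixFF 0)) κ κ' (Sum.inl α) (Sum.inl β) := by
  obtain ⟨C₀, C₁, δ₀, hδ₀, -, -, h₀, h₁⟩ := shape_pair hLc cE cVH cΛ cE₂ cB Tc hmix
  exact zff_sub_iff h₁ h₀ hδ₀

/-- **ROW W3-F4d, `hZ0` FROM CHARGE CONSERVATION** (the direction PART 2 will use): if the ff-charge of member `1` equals that of member `0`,
then the END's `hZ0` holds, in its literal `Zfree (D 0)` form with `Zfree X := ∀ κ κ′ α β, zmode Lc X κ κ′ (inl α) (inl β) = 0`. -/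
theorem hZ0_of_chargeConserved (hLc : 1 ≤ Lc) (cE cVH cΛ cE₂ cB : ℝ) (Tc : Fin 4 → Fin 4 → Fin 4 → Fin 4 → ℝ)
    {mixFF : Fin (d + 1) → (Fin (d + 1) → ℤ) → Fin (d + 1) → (Fin (d + 1) → ℤ) → MKer (d + 1) (Fib d)}
    (hmix : ∃ C δ : ℝ, 0 < δ ∧ LocStencilFM Lc mixFF C δ)
    (hcons : ∀ (κ κ' α β : Fin (d + 1)),
        zmode Lc (unitS₂ (sfStep Lc 1) (smStep d Lc 1) (T2Of d Lc cE cVH cΛ cE₂ cB Tc (vh₂S d Lc) mixFF 1)) κ κ' (Sum.inl α) (Sum.inl β)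
          = zmode Lc (unitS₂ (sfStep Lc 0) (smStep d Lc 0) (T2Of d Lc cE cVH cΛ cE₂ cB Tc (vh₂S d Lc) mixFF 0)) κ κ' (Sum.inl α) (Sum.inl β)) :
    (fun X : Fin (d + 1) → (Fin (d + 1) → ℤ) → Fin (d + 1) → (Fin (d + 1) → ℤ) → MKer (d + 1) (Fib d) =>
        ∀ (κ κ' α β : Fin (d + 1)), zmode Lc X κ κ' (Sum.inl α) (Sum.inl β) = 0)
      (fun κ u κ' u' =>
        unitS₂ (sfStep Lc 1) (smStep d Lc 1) (T2Of d Lc cE cVH cΛ cE₂ cB Tc (vh₂S d Lc) mixFF 1) κ u κ' u'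
          - unitS₂ (sfStep Lc 0) (smStep d Lc 0) (T2Of d Lc cE cVH cΛ cE₂ cB Tc (vh₂S d Lc) mixFF 0) κ u κ' u') :=
  (hZ0_iff_chargeConserved hLc cE cVH cΛ cE₂ cB Tc hmix).2 hcons

end Pin


/-! ## §3″ (v1.1) The pin side in the POINTWISE transversal currency (leaf-16-g12's «ZFREE-POINTWISE», `TransversalZeroMode` p211950) -/

section Pointwise

variable {A B : Fin (d + 1) → (Fin (d + 1) → ℤ) → Fin (d + 1) → (Fin (d + 1) → ℤ) → MKer (d + 1) (Fib d)} {CA CB δ : ℝ}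

/-- [folklore] **POINTWISE INNER SUMS ARE SUBTRACTIVE ON `LocStencil₂` TABLES** (every first bond `u`): leaf-16-g12's
`TransversalZeroMode.inner_sub_eq` with its six nested summabilities DISCHARGED by §3's `summable_z` ∕ `summable_xz` ∕ `summable_u'xz`. -/
theorem inner_sub_of_locStencil₂ (hA : LocStencil₂ A CA δ) (hB : LocStencil₂ B CB δ) (hδ : 0 < δ)
    (κ : Fin (d + 1)) (u : Fin (d + 1) → ℤ) (κ' : Fin (d + 1)) (a b : Fib d) :
    (∑' u', ∑' x, ∑' z, (A κ u κ' u' - B κ u κ' u') x z a b)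
      = (∑' u', ∑' x, ∑' z, A κ u κ' u' x z a b) - ∑' u', ∑' x, ∑' z, B κ u κ' u' x z a b :=
  TransversalZeroMode.inner_sub_eq (X := A) (Y := B) κ u κ' a b
    (fun u' x => summable_z (hA κ u κ' u') hδ x a b) (fun u' x => summable_z (hB κ u κ' u') hδ x a b)
    (fun u' => summable_xz (hA κ u κ' u') hδ a b) (fun u' => summable_xz (hB κ u κ' u') hδ a b)
    (summable_u'xz hA hδ κ u κ' a b) (summable_u'xz hB hδ κ u κ' a b)

/-- [folklore] **POINTWISE: ZERO ff INNER SUMS OF A DIFFERENCE ⟺ EQUAL ff INNER SUMS** (every first bond). -/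
theorem innerff_sub_iff (hA : LocStencil₂ A CA δ) (hB : LocStencil₂ B CB δ) (hδ : 0 < δ) :
    (∀ (κ : Fin (d + 1)) (u : Fin (d + 1) → ℤ) (κ' α β : Fin (d + 1)),
        (∑' u', ∑' x, ∑' z, (A κ u κ' u' - B κ u κ' u') x z (Sum.inl α) (Sum.inl β)) = 0) ↔
      ∀ (κ : Fin (d + 1)) (u : Fin (d + 1) → ℤ) (κ' α β : Fin (d + 1)),
        (∑' u', ∑' x, ∑' z, A κ u κ' u' x z (Sum.inl α) (Sum.inl β))
          = ∑' u', ∑' x, ∑' z, B κ u κ' u' x z (Sum.inl α) (Sum.inl β) := by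
  simp only [inner_sub_of_locStencil₂ hA hB hδ, sub_eq_zero]

variable {Lc : ℕ} [NeZero Lc]

/-- **ROW W3-F4d, `hZ0` ⟺ POINTWISE ff-CHARGE CONSERVATION AT THE FIRST STEP** (the pointwise-`Zfree` twin of `hZ0_iff_chargeConserved`):
with `Zfree X := ∀ κ u κ′ α β, Σ'_{u′xz} X κ u κ′ u′ x z (inl α) (inl β) = 0`, the END's `hZ0 : Zfree (T♮₁ − T♮₀)` holds IFF the ff inner sums
of members `1` and `0` agree at EVERY first bond. -/
theorem hZ0pt_iff_chargeConservedPt (hLc : 1 ≤ Lc) (cE cVH cΛ cE₂ cB : ℝ) (Tc : Fin 4 → Fin 4 → Fin 4 → Fin 4 → ℝ)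
    {mixFF : Fin (d + 1) → (Fin (d + 1) → ℤ) → Fin (d + 1) → (Fin (d + 1) → ℤ) → MKer (d + 1) (Fib d)}
    (hmix : ∃ C δ : ℝ, 0 < δ ∧ LocStencilFM Lc mixFF C δ) :
    (∀ (κ : Fin (d + 1)) (u : Fin (d + 1) → ℤ) (κ' α β : Fin (d + 1)),
        (∑' u', ∑' x, ∑' z,
          (unitS₂ (sfStep Lc 1) (smStep d Lc 1) (T2Of d Lc cE cVH cΛ cE₂ cB Tc (vh₂S d Lc) mixFF 1) κ u κ' u'
            - unitS₂ (sfStep Lc 0) (smStep d Lc 0) (T2Of d Lc cE cVH cΛ cE₂ cB Tc (vh₂S d Lc) mixFF 0) κ u κ' u') x z (Sum.inl α) (Sum.inl β)) = 0) ↔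
      ∀ (κ : Fin (d + 1)) (u : Fin (d + 1) → ℤ) (κ' α β : Fin (d + 1)),
        (∑' u', ∑' x, ∑' z,
            unitS₂ (sfStep Lc 1) (smStep d Lc 1) (T2Of d Lc cE cVH cΛ cE₂ cB Tc (vh₂S d Lc) mixFF 1) κ u κ' u' x z (Sum.inl α) (Sum.inl β))
          = ∑' u', ∑' x, ∑' z,
            unitS₂ (sfStep Lc 0) (smStep d Lc 0) (T2Of d Lc cE cVH cΛ cE₂ cB Tc (vh₂S d Lc) mixFF 0) κ u κ' u' x z (Sum.inl α) (Sum.inl β) := by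
  obtain ⟨C₀, C₁, δ₀, hδ₀, -, -, h₀, h₁⟩ := shape_pair hLc cE cVH cΛ cE₂ cB Tc hmix
  exact innerff_sub_iff h₁ h₀ hδ₀

/-- **ROW W3-F4d, `hZ0` (pointwise `Zfree`) FROM POINTWISE CHARGE CONSERVATION** — concluding LITERALLY
`(fun X ↦ ∀ κ u κ′ α β, Σ'_{u′} Σ'_x Σ'_z X κ u κ′ u′ x z (inl α) (inl β) = 0) (D 0)`. -/
theorem hZ0pt_of_chargeConservedPt (hLc : 1 ≤ Lc) (cE cVH cΛ cE₂ cB : ℝ) (Tc : Fin 4 → Fin 4 → Fin 4 → Fin 4 → ℝ)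
    {mixFF : Fin (d + 1) → (Fin (d + 1) → ℤ) → Fin (d + 1) → (Fin (d + 1) → ℤ) → MKer (d + 1) (Fib d)}
    (hmix : ∃ C δ : ℝ, 0 < δ ∧ LocStencilFM Lc mixFF C δ)
    (hcons : ∀ (κ : Fin (d + 1)) (u : Fin (d + 1) → ℤ) (κ' α β : Fin (d + 1)),
        (∑' u', ∑' x, ∑' z,
            unitS₂ (sfStep Lc 1) (smStep d Lc 1) (T2Of d Lc cE cVH cΛ cE₂ cB Tc (vh₂S d Lc) mixFF 1) κ u κ' u' x z (Sum.inl α) (Sum.inl β))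
          = ∑' u', ∑' x, ∑' z,
            unitS₂ (sfStep Lc 0) (smStep d Lc 0) (T2Of d Lc cE cVH cΛ cE₂ cB Tc (vh₂S d Lc) mixFF 0) κ u κ' u' x z (Sum.inl α) (Sum.inl β)) :
    (fun X : Fin (d + 1) → (Fin (d + 1) → ℤ) → Fin (d + 1) → (Fin (d + 1) → ℤ) → MKer (d + 1) (Fib d) =>
        ∀ (κ : Fin (d + 1)) (u : Fin (d + 1) → ℤ) (κ' α β : Fin (d + 1)),
          (∑' u', ∑' x, ∑' z, X κ u κ' u' x z (Sum.inl α) (Sum.inl β)) = 0)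
      (fun κ u κ' u' =>
        unitS₂ (sfStep Lc 1) (smStep d Lc 1) (T2Of d Lc cE cVH cΛ cE₂ cB Tc (vh₂S d Lc) mixFF 1) κ u κ' u'
          - unitS₂ (sfStep Lc 0) (smStep d Lc 0) (T2Of d Lc cE cVH cΛ cE₂ cB Tc (vh₂S d Lc) mixFF 0) κ u κ' u') :=
  (hZ0pt_iff_chargeConservedPt hLc cE cVH cΛ cE₂ cB Tc hmix).2 hcons

end Pointwise

end Summit.QuantumFields.BalabanUV.Beta.GAN24.WSlotFirstDiff

end
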